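import Mathlib.RingTheory.Ideal.Maximal
import Mathlib.RingTheory.Ideal.Maps
import Mathlib.Algebra.Algebra.Subalgebra.Lattice
import HarnessLib

/-!
# Conductors moved by translations: a subalgebra whose conductor ideals lie in no maximal ideal
# contains the bigger algebra (the «homogeneity endgame» of the orbit-quotient theorem)

Topic `Literature/RingTheory/IntegralClosure`. THEOREMS ONLY (no definition, no named fact; D-0026).
Programme #7 of the cell `val-lit` (discharge of `Grosshans1997_thm_1_11_slOrbit_forms`, architect
val-lit-t02 g7, NOTE `HOME/bip/NOTE-t02g7-E2-Grosshans-orbit-quotient-sizing.md`, step S10), group-free.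

Let `A, B` be subalgebras of a commutative algebra `C`. For `b ∈ C` the **conductor** of `b` into `A` is the
ideal `J_b = {x ∈ A | x·b ∈ A}` of `A`; `b ∈ A` iff `1 ∈ J_b` iff `J_b` lies in no maximal ideal of `A`.
* `le_of_forall_pow_mul_mem`: if a family `S ⊆ A` conducts every `b ∈ B` into `A` after a power
  (`s^M b ∈ A`) and no maximal ideal of `A` contains all of `S`, then `B ≤ A`.
* `le_of_pow_mul_mem_of_translates`: the family = the translates `φ_γ c` of ONE conductor `c ∈ A` under
  algebra endomorphisms `φ_γ` of `C` (with right inverses `ψ_γ`) preserving `A` (and `ψ_γ` preserving `B`):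
  it suffices that every maximal ideal of `A` misses some translate («the group moves the denominator off
  every point»).
* `le_of_denominators_of_translates`: the same from the output shape of Zariski's Main Theorem +
  birationality (`InjectiveOnPointsBirational.exists_denominators_of_injective_on_maximalIdeals`):
  `a ∈ A`, `a·r ∈ A`, and `a·r^N·b ∈ A` for every `b ∈ B` (`N` depending on `b`); conductor `c := a·(a·r)`.

In the orbit-quotient proof: `C = (SL_σ(ℂ) → ℂ)`, `A = ℂ[SL·w]` (pull-backs along the orbit map),
`B = ℂ[SL]^{G_w}`, `φ_γ = ψ_{γ⁻¹} =` left translation, maximal ideals of `A` = points of the closed orbit,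
and a non-zero function on the (irreducible) orbit is non-zero at some point, which `SL` moves anywhere.
Honest framing: elementary commutative algebra; nothing here bears on VP versus VNP.
[cite: Grosshans1997, Thm. 1.11 (= Borel, LAG, Prop. 6.7; the step "k[G]^H = k[G·x]")]

## References

* F. D. Grosshans, *Algebraic Homogeneous Spaces and Invariant Theory*, LNM 1673 (1997), §1, Thm. 1.11.
  [Grosshans1997]

## Mathlib

`Ideal.exists_le_maximal`, `Ideal.IsPrime.mem_of_pow_mem`, `Subalgebra` API. The conductor ideal is built
inline (anonymous `Ideal` structure) — no definition is introduced.
-/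

namespace Literature.RingTheory.IntegralClosure.ConductorTranslates

variable {R C : Type*} [CommRing R] [CommRing C] [Algebra R C]

/-- **`b ∈ A` as soon as, for every maximal ideal `m` of `A`, some `x ∈ A ∖ m` has `x·b ∈ A`** (the conductor
ideal `J_b = {x ∈ A | x b ∈ A}` then lies in no maximal ideal, so `1 ∈ J_b`) — the conductor step of the
proof that the orbit map onto a closed orbit is a quotient. [cite: Grosshans1997, Thm. 1.11 (proof, final step; = Borel, LAG, Prop. 6.7)] -/
theorem mem_of_forall_isMaximal_exists_mul_mem (A : Subalgebra R C) (b : C)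
    (h : ∀ m : Ideal A, m.IsMaximal → ∃ x : A, (x : C) * b ∈ A ∧ x ∉ m) : b ∈ A := by
  -- the conductor ideal of `b` into `A`, built inline
  let J : Ideal A :=
    { carrier := {x | (x : C) * b ∈ A}
      add_mem' := fun {x y} hx hy => by
        simp only [Set.mem_setOf_eq, Subalgebra.coe_add, add_mul] at *
        exact add_mem hx hy
      zero_mem' := by simp
      smul_mem' := fun x {y} hy => by
        simp only [Set.mem_setOf_eq, smul_eq_mul, Subalgebra.coe_mul, mul_assoc] at *
        exact A.mul_mem x.2 hy }
  have hJ : J = ⊤ := by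
    by_contra hne
    obtain ⟨m, hm, hJm⟩ := Ideal.exists_le_maximal J hne
    obtain ⟨x, hxb, hxm⟩ := h m hm
    exact hxm (hJm hxb)
  have h1 : (1 : A) ∈ J := by rw [hJ]; exact Submodule.mem_top
  have h1' : ((1 : A) : C) * b ∈ A := h1
  rwa [Subalgebra.coe_one, one_mul] at h1'

/-- **Homogeneity endgame, abstract form.** Two subalgebras `A, B` of `C` and a family `S ⊆ A` such that
every `s ∈ S` conducts every `b ∈ B` into `A` after a power (`s^M b ∈ A`), while no maximal ideal of `A`
contains all of `S`. Then `B ≤ A` (a maximal ideal is prime: it would contain `s` together with `s^M`).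
[cite: Grosshans1997, Thm. 1.11 (proof, final step; = Borel, LAG, Prop. 6.7)] -/
theorem le_of_forall_pow_mul_mem {A B : Subalgebra R C} (S : Set C) (hS : S ⊆ A)
    (hpow : ∀ s ∈ S, ∀ b ∈ B, ∃ M : ℕ, s ^ M * b ∈ A)
    (hmax : ∀ m : Ideal A, m.IsMaximal → ∃ (s : C) (hs : s ∈ S), (⟨s, hS hs⟩ : A) ∉ m) :
    B ≤ A := by
  intro b hb
  refine mem_of_forall_isMaximal_exists_mul_mem A b fun m hm => ?_
  obtain ⟨s, hs, hsm⟩ := hmax m hm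
  obtain ⟨M, hM⟩ := hpow s hs b hb
  refine ⟨⟨s, hS hs⟩ ^ M, ?_, fun hmem => hsm (hm.isPrime.mem_of_pow_mem M hmem)⟩
  rw [Subalgebra.coe_pow]
  exact hM

/-- **Homogeneity endgame for a family of translations.** `A, B ≤ C`; algebra endomorphisms `φ γ` of `C`
with right inverses `ψ γ` (`φ γ (ψ γ x) = x`), `φ γ` preserving `A` and `ψ γ` preserving `B`; one element
`c ∈ A` conducting all of `B` into `A` after a power; and for every maximal ideal `m` of `A` a translate
`φ γ c ∉ m` («the group moves the denominator off every point»). Then `B ≤ A`.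
[cite: Grosshans1997, Thm. 1.11 (proof, final step; = Borel, LAG, Prop. 6.7)] -/
theorem le_of_pow_mul_mem_of_translates {Γ : Type*} {A B : Subalgebra R C}
    (φ ψ : Γ → (C →ₐ[R] C)) (hφψ : ∀ γ x, φ γ (ψ γ x) = x)
    (hφA : ∀ γ, ∀ a ∈ A, φ γ a ∈ A) (hψB : ∀ γ, ∀ b ∈ B, ψ γ b ∈ B) {c : C} (hc : c ∈ A)
    (hpow : ∀ b ∈ B, ∃ M : ℕ, c ^ M * b ∈ A)
    (hmax : ∀ m : Ideal A, m.IsMaximal → ∃ γ, (⟨φ γ c, hφA γ c hc⟩ : A) ∉ m) :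
    B ≤ A := by
  refine le_of_forall_pow_mul_mem (Set.range fun γ => φ γ c)
    (by rintro _ ⟨γ, rfl⟩; exact hφA γ c hc) ?_ ?_
  · rintro _ ⟨γ, rfl⟩ b hb
    obtain ⟨M, hM⟩ := hpow (ψ γ b) (hψB γ b hb)
    refine ⟨M, ?_⟩
    have := hφA γ _ hM
    rwa [map_mul, map_pow, hφψ] at this
  · intro m hm
    obtain ⟨γ, hγ⟩ := hmax m hm
    exact ⟨φ γ c, ⟨γ, rfl⟩, hγ⟩

/-- **Homogeneity endgame from Zariski–Main-Theorem denominators.** `A, B ≤ C`, translations `φ γ` / `ψ γ`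
as above; `a ∈ A` and `r ∈ C` with `a·r ∈ A` and, for every `b ∈ B`, `a·r^N·b ∈ A` for some `N` (the output
shape of `InjectiveOnPointsBirational.exists_denominators_of_injective_on_maximalIdeals` plus `a·r ∈ A`);
and every maximal ideal of `A` misses some translate `φ γ (a·(a·r))`. Then `B ≤ A` (previous lemma with
the conductor `c := a·(a·r)`: `c^N b = a^{2N-1}·(a r^N b)`).
[cite: Grosshans1997, Thm. 1.11 (proof, final step; = Borel, LAG, Prop. 6.7)] -/
theorem le_of_denominators_of_translates {Γ : Type*} {A B : Subalgebra R C}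
    (φ ψ : Γ → (C →ₐ[R] C)) (hφψ : ∀ γ x, φ γ (ψ γ x) = x)
    (hφA : ∀ γ, ∀ a ∈ A, φ γ a ∈ A) (hψB : ∀ γ, ∀ b ∈ B, ψ γ b ∈ B) {a r : C} (ha : a ∈ A)
    (har : a * r ∈ A) (hpow : ∀ b ∈ B, ∃ N : ℕ, a * r ^ N * b ∈ A)
    (hmax : ∀ m : Ideal A, m.IsMaximal → ∃ γ, (⟨φ γ (a * (a * r)), hφA γ _ (A.mul_mem ha har)⟩ : A) ∉ m) :
    B ≤ A := by
  refine le_of_pow_mul_mem_of_translates φ ψ hφψ hφA hψB (A.mul_mem ha har) (fun b hb => ?_) hmax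
  obtain ⟨N, hN⟩ := hpow b hb
  rcases Nat.eq_zero_or_pos N with hN0 | hNpos
  · -- `a b ∈ A`: then `(a (a r)) b = (a r) (a b) ∈ A`
    subst hN0
    rw [pow_zero, mul_one] at hN
    refine ⟨1, ?_⟩
    rw [pow_one, show a * (a * r) * b = (a * r) * (a * b) by ring]
    exact A.mul_mem har hN
  · refine ⟨N, ?_⟩
    have key : (a * (a * r)) ^ N * b = a ^ (2 * N - 1) * (a * r ^ N * b) := by
      obtain ⟨M, rfl⟩ : ∃ M, N = M + 1 := ⟨N - 1, by omega⟩
      rw [show 2 * (M + 1) - 1 = 2 * M + 1 by omega]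
      ring
    rw [key]
    exact A.mul_mem (A.pow_mem ha _) hN

end Literature.RingTheory.IntegralClosure.ConductorTranslates
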